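import Summits.BirchSwinnertonDyer.BirchSwinnertonDyer.Theorems.EisensteinPrimesMazurMCOnCellBTwistbackTwistDoor
import Summits.BirchSwinnertonDyer.BirchSwinnertonDyer.Theorems.EisensteinPrimesMazurMCOnCellBTwistbackSubrowDatumCanonical
import Summits.BirchSwinnertonDyer.BirchSwinnertonDyer.Theorems.EisensteinPrimesMazurMCOnCellBTwistbackTwoStepDefs
import Summits.BirchSwinnertonDyer.Rank1Residual.X2.RankOneNonsplitTransfer
import Literature.NumberTheory.EllipticCurves.ModularityVersionApProofs
import HarnessLib

/-!
# Crux 3 `MazurMCOnCellB` (stmt-BirchSwinnertonDyer-19033), line `twistback` v12 — lane ISO-4a: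
# the sub-row datum PASSES TO THE ADMISSIBLE TWIST PARTNER `E^{(d_K)}` (hence moves along certified two-steps)

Width seat bsd-line-x2-p1-w7 (gen 4), cell `bsd-eis` (run/shared/lean/pub/bsd-eis/), 2026-08-29; sequel of ISO-2
(`…TwistbackSubrowDatumIsogeny`: the datum is a CLASS datum), ISO-3 (`…LocalBalanceAtGoodPlace`: Greenberg–Vatsal
Prop. (2.4) at a good place) and ISO-3b (`…TwistbackSubrowDatumCanonical`: canonical `S₀`). HONEST FRAMING: TOOL
THEOREMS ONLY (no `def`, no named fact, no `sorry`); every input a tree THEOREM; `--supports`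
stmt-BirchSwinnertonDyer-19033; closes no stub; no summit statement, no Mazur main conjecture, no BSD is proved for
any curve; 0 cells / labels / stubs / tiers move.

WHAT. Let `(W, 3)` be multiplicative at `3` and ON THE SUB-ROW (the first negated hypothesis of the registered v12
stub `stub_offSubrow_connectedShaUnitOrPartner`, VERBATIM: `3` non-split, a rational `3`-line with primitive
presentations `(m, φ)`, `(d, ψ)`, a finite `S₀ ∌ (3)` off which `W` is good, balance
`1 + Σ_{S₀} δ = Σ_{S₀} (s[φ = ℓ̄] + s[ψ = ℓ̄])`). Let `K` be an imaginary quadratic field with `d_K` odd, Heegner for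
`N_W` and for `3`, and `Wd` ANY globally minimal model of `E^{(d_K)}`. Then `(Wd, 3)` is on the sub-row, with
`S₀′ = {bad places of W other than (3)} ∪ {v : ℓ_v ∣ d_K}` and presentations `(φχ̄_K, ψχ̄_K)`
(`subrowDatum_twist`). This is the hypothesis-side companion of x2-p1-w3 g10's `…TwistbackTwistDoor` (which moves the
KL-flat CARRIER clause to the twist in the two X2b shapes): no shape (ramified-odd / unramified-even), no `p ∣ m`, no
unit hypotheses — and the two side conditions of that door, `gcd(m, d_K) = gcd(d, d_K) = 1` and `ℓ_v ∣ N_W` on `S₀`,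
are DISCHARGED here: the first by ISO-3 §2 (`not_dvd_level_sub_of_good`: the primes of `d_K` are good for `W` and
`≠ 3`, so prime to the conductors of the primitive presentations), the second by ISO-3b (canonical `S₀` = bad places)
and `dvd_conductorNorm_iff`.

* §1 `coprime_level_of_good_off` — `gcd(m, n) = 1` when every prime of `n` is a good place `≠ p` of `W` (ISO-3 §2).
* §2 **`subrowDatum_twist`** — the step `W ↦ Wd` above (line: the sign-equivariant identification
  `…TwistLineCharactersPackage.exists_signEquiv_signs` and `…TwistLineCharacters.smul_eq_twistChar_of_mem_map_symm` /
  `smul_sub_twistChar_mem_map_symm`, primitivity `isPrimitive_changeLevel_mul_changeLevel`; balance: «c(E^K) = c(E)»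
  `…TwistLocalBalance.balance_union_iff` with `delta_twist_eq_of_heegner`, `delta_twist_eq_zero_of_dvd_discr`,
  `chi_natCast_eq_one_of_heegner'`; non-split at `3`: `X2.not_hasSplitMultiplicativeReductionAtPrime_of_smul_eq_quadraticTwist`).
* §3 **`subrowDatum_of_twoStepAt`** — along a certified two-step edge `TwoStepAt 3 W W″` (two applications of §2: the
  second field `K″` is Heegner for `N_{Wd}`): the sub-row is CLOSED DOWNSTREAM in the admissible double-twist graph; with
  ISO-2 (isogeny at both ends) every vertex forward-reachable from a sub-row class is on the sub-row.

References: [GreenbergVatsal2000] Thm. (1.3), §2 Prop. (2.4) p. 22, p. 28, §3 (28) p. 42; [SilvermanAEC2009] X.5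
Cor. 5.4, VII.5 Prop. 5.1; [SilvermanATAEC1994] IV.9.4, IV.10.2; [Cox2013] §1.C (1.17); [IrelandRosen1990] Ch. 20 §5
Prop. 20.5.4; [GrossZagier1986] §I.1 (the Heegner hypothesis).
-/

set_option autoImplicit false

-- `Summit.BirchSwinnertonDyer.BirchSwinnertonDyer.…`: the summit and its single sub-problem share a name.
set_option linter.dupNamespace false

noncomputable section

open scoped Classical NumberTheorySymbols

open WeierstrassCurve NumberField IsDedekindDomain Field DirichletCharacter
  Literature.NumberTheory.EllipticCurves Literature.NumberTheory.GaloisRepresentations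
  Literature.NumberTheory.EllipticCurves.GreenbergVatsal2000
  Literature.NumberTheory.EllipticCurves.Rank1Residual
  Literature.NumberTheory.QuadraticFields Literature.NumberTheory.QuadraticFields.Quadratic
  Summit.BirchSwinnertonDyer.Rank1Residual Summit.BirchSwinnertonDyer.Rank1Residual.X2
  Summit.BirchSwinnertonDyer.BirchSwinnertonDyer.Theorems.EisensteinPrimesMazurMCOnCellBTwistbackTwistLineCharacters
  Summit.BirchSwinnertonDyer.BirchSwinnertonDyer.Theorems.EisensteinPrimesMazurMCOnCellBTwistbackTwistLineCharactersPackage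
  Summit.BirchSwinnertonDyer.BirchSwinnertonDyer.Theorems.EisensteinPrimesMazurMCOnCellBTwistbackQuadraticRadical
  Summit.BirchSwinnertonDyer.BirchSwinnertonDyer.Theorems.EisensteinPrimesMazurMCOnCellBTwistbackTwistLocalBalance
  Summit.BirchSwinnertonDyer.BirchSwinnertonDyer.Theorems.EisensteinPrimesMazurMCOnCellBTwistbackTwistDoor
  Summit.BirchSwinnertonDyer.BirchSwinnertonDyer.Theorems.EisensteinPrimesMazurMCOnCellBTwistbackTwoStepDefs
  Summit.BirchSwinnertonDyer.BirchSwinnertonDyer.Theorems.EisensteinPrimesLocalBalanceAtGoodPlace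
  Summit.BirchSwinnertonDyer.BirchSwinnertonDyer.Theorems.EisensteinPrimesMazurMCOnCellBTwistbackSubrowDatumCanonical

namespace Summit.BirchSwinnertonDyer.BirchSwinnertonDyer.Theorems.EisensteinPrimesMazurMCOnCellBTwistbackSubrowDatumTwistStep

/-! ## §1. The conductors of the primitive presentations are prime to `d_K` -/

/-- **`gcd(m, n) = 1` when every prime of `n` is a GOOD place `≠ p` of `W`**, for the primitive character `φ` (mod `m`)
of a rational `p`-line of `W` (ISO-3 §2: `ℓ ∤ m` at every good `ℓ ≠ p`). [cite: Washington1997, Ch. 3 (conductor and ramification)] -/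
theorem coprime_level_of_good_off {W : WeierstrassCurve ℚ} [W.IsElliptic] {p : ℕ} [hp : Fact p.Prime]
    {Φ₀ : AddSubgroup (geomTorsion W (p : ℤ))} (hΦ : IsRationalLine W p Φ₀)
    {m : ℕ} [NeZero m] {φ : DirichletCharacter (ZMod p) m} {d : ℕ} [NeZero d] {ψ : DirichletCharacter (ZMod p) d}
    (hφ : φ.IsPrimitive) (hψ : ψ.IsPrimitive)
    (hφ0 : ∀ (σ : absoluteGaloisGroup ℚ), ∀ P ∈ Φ₀,
      σ • P = (φ ((modNCyclotomicCharacter ℚ m σ : (ZMod m)ˣ) : ZMod m)).val • P)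
    (hψ0 : ∀ (σ : absoluteGaloisGroup ℚ) (Q : geomTorsion W (p : ℤ)),
      σ • Q - (ψ ((modNCyclotomicCharacter ℚ d σ : (ZMod d)ˣ) : ZMod d)).val • Q ∈ Φ₀)
    {n : ℕ} (hn : ∀ v : HeightOneSpectrum (𝓞 ℚ), Rat.HeightOneSpectrum.natGenerator v ∣ n →
      ((p : ℕ) : 𝓞 ℚ) ∉ v.asIdeal ∧ W.HasGoodReductionAt v) :
    m.Coprime n ∧ d.Coprime n := by
  have key : ∀ ℓ : ℕ, ℓ.Prime → ℓ ∣ n →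
      ¬ ℓ ∣ m ∧ ¬ ℓ ∣ d := by
    intro ℓ hℓ hℓn
    -- the place `v = (ℓ)`
    set v : HeightOneSpectrum (𝓞 ℚ) := (Rat.HeightOneSpectrum.primesEquiv (R := 𝓞 ℚ)).symm ⟨ℓ, hℓ⟩ with hv
    have hgen : Rat.HeightOneSpectrum.natGenerator v = ℓ :=
      congrArg Subtype.val ((Rat.HeightOneSpectrum.primesEquiv (R := 𝓞 ℚ)).apply_symm_apply ⟨ℓ, hℓ⟩)
    obtain ⟨hpv, hgood⟩ := hn v (hgen ▸ hℓn)
    rw [← hgen]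
    exact ⟨not_dvd_level_sub_of_good hgood hpv hΦ hφ hφ0, not_dvd_level_quot_of_good hgood hpv hΦ hψ hφ0 hψ0⟩
  exact ⟨Nat.Coprime.symm (Nat.coprime_of_dvd fun ℓ hℓ hℓn hℓm ↦ (key ℓ hℓ hℓn).1 hℓm),
    Nat.Coprime.symm (Nat.coprime_of_dvd fun ℓ hℓ hℓn hℓd ↦ (key ℓ hℓ hℓn).2 hℓd)⟩

/-! ## §2. The step `W ↦ E^{(d_K)}` for an admissible `K` -/

/-- **THE SUB-ROW DATUM PASSES TO THE ADMISSIBLE TWIST PARTNER.** `W` globally minimal, MULTIPLICATIVE at `3` and on the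
sub-row (the registered datum, VERBATIM); `K` imaginary quadratic, `d_K` odd, Heegner for `N_W` and for `3`; `Wd` any
globally minimal model of `E^{(d_K)}`. Then `Wd` is on the sub-row: NON-split at `3` (`3` splits in `K`), line
`e⁻¹(Φ₀)` with the PRIMITIVE presentations `(φχ̄_K mod m|d_K|, ψχ̄_K mod d|d_K|)`,
`S₀′ = {bad places of W ≠ (3)} ∪ {v : ℓ_v ∣ d_K}`, and the SAME balance («c(E^K) = c(E)»: `δ` and the indicators agree
at the bad places of `W`, which split in `K`; both sides vanish at the primes of `d_K`, where the twist is additive and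
the twisted characters ramify). [cite: GreenbergVatsal2000, §2 Prop. (2.4) p. 22, p. 28 and §3 (28) p. 42]
[cite: SilvermanAEC2009, X.5 Cor. 5.4 and VII.5 Prop. 5.1] [cite: Cox2013, §1.C Lemma 1.14 and (1.17)] -/
theorem subrowDatum_twist (W : WeierstrassCurve ℚ) [W.IsElliptic] [W.IsGloballyMinimal]
    (K : Type) [Field K] [NumberField K] (hK : IsImaginaryQuadratic K) (hodd : Odd (NumberField.discr K))
    (hHN : SatisfiesHeegnerHypothesis (W.conductorNorm ℤ) K) (hH3 : SatisfiesHeegnerHypothesis 3 K)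
    (Wd : WeierstrassCurve ℚ) [Wd.IsElliptic] [Wd.IsGloballyMinimal]
    (C : VariableChange ℚ) (hC : C • Wd = W.quadraticTwist (NumberField.discr K : ℚ))
    (hmult : W.HasMultiplicativeReductionAtPrime 3) (q : ℕ)
    (hD : q = 3 ∧ ¬ W.HasSplitMultiplicativeReductionAtPrime 3 ∧
      ∃ (Φ₀ : AddSubgroup (geomTorsion W (3 : ℤ))) (m : ℕ) (_ : NeZero m) (φ : DirichletCharacter (ZMod 3) m)
        (d : ℕ) (_ : NeZero d) (ψ : DirichletCharacter (ZMod 3) d) (S₀ : Finset (HeightOneSpectrum (𝓞 ℚ))),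
        IsRationalLine W 3 Φ₀ ∧ φ.IsPrimitive ∧ ψ.IsPrimitive ∧
        (∀ (σ : absoluteGaloisGroup ℚ), ∀ P ∈ Φ₀,
          σ • P = (φ ((modNCyclotomicCharacter ℚ m σ : (ZMod m)ˣ) : ZMod m)).val • P) ∧
        (∀ (σ : absoluteGaloisGroup ℚ) (P : geomTorsion W (3 : ℤ)),
          σ • P - (ψ ((modNCyclotomicCharacter ℚ d σ : (ZMod d)ˣ) : ZMod d)).val • P ∈ Φ₀) ∧
        (∀ v ∈ S₀, ((3 : ℕ) : 𝓞 ℚ) ∉ v.asIdeal) ∧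
        (∀ v : HeightOneSpectrum (𝓞 ℚ), v ∉ S₀ → ((3 : ℕ) : 𝓞 ℚ) ∉ v.asIdeal → W.HasGoodReductionAt v) ∧
        1 + ∑ v ∈ S₀, delta W 3 v =
          ∑ v ∈ S₀, ((if φ (Rat.HeightOneSpectrum.natGenerator v : ZMod m) =
                (Rat.HeightOneSpectrum.natGenerator v : ZMod 3)
              then sFactor 3 (Rat.HeightOneSpectrum.natGenerator v) else 0) +
            (if ψ (Rat.HeightOneSpectrum.natGenerator v : ZMod d) =
                (Rat.HeightOneSpectrum.natGenerator v : ZMod 3)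
              then sFactor 3 (Rat.HeightOneSpectrum.natGenerator v) else 0))) :
    q = 3 ∧ ¬ Wd.HasSplitMultiplicativeReductionAtPrime 3 ∧
      ∃ (Φ₀ : AddSubgroup (geomTorsion Wd (3 : ℤ))) (m : ℕ) (_ : NeZero m) (φ : DirichletCharacter (ZMod 3) m)
        (d : ℕ) (_ : NeZero d) (ψ : DirichletCharacter (ZMod 3) d) (S₀ : Finset (HeightOneSpectrum (𝓞 ℚ))),
        IsRationalLine Wd 3 Φ₀ ∧ φ.IsPrimitive ∧ ψ.IsPrimitive ∧
        (∀ (σ : absoluteGaloisGroup ℚ), ∀ P ∈ Φ₀,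
          σ • P = (φ ((modNCyclotomicCharacter ℚ m σ : (ZMod m)ˣ) : ZMod m)).val • P) ∧
        (∀ (σ : absoluteGaloisGroup ℚ) (P : geomTorsion Wd (3 : ℤ)),
          σ • P - (ψ ((modNCyclotomicCharacter ℚ d σ : (ZMod d)ˣ) : ZMod d)).val • P ∈ Φ₀) ∧
        (∀ v ∈ S₀, ((3 : ℕ) : 𝓞 ℚ) ∉ v.asIdeal) ∧
        (∀ v : HeightOneSpectrum (𝓞 ℚ), v ∉ S₀ → ((3 : ℕ) : 𝓞 ℚ) ∉ v.asIdeal → Wd.HasGoodReductionAt v) ∧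
        1 + ∑ v ∈ S₀, delta Wd 3 v =
          ∑ v ∈ S₀, ((if φ (Rat.HeightOneSpectrum.natGenerator v : ZMod m) =
                (Rat.HeightOneSpectrum.natGenerator v : ZMod 3)
              then sFactor 3 (Rat.HeightOneSpectrum.natGenerator v) else 0) +
            (if ψ (Rat.HeightOneSpectrum.natGenerator v : ZMod d) =
                (Rat.HeightOneSpectrum.natGenerator v : ZMod 3)
              then sFactor 3 (Rat.HeightOneSpectrum.natGenerator v) else 0)) := by
  have hp2 : (3 : ℕ) ≠ 2 := by decide
  have h2 : Module.finrank ℚ K = 2 := hK.1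
  have hDneg : NumberField.discr K < 0 := hK.discr_neg
  obtain ⟨hD4, hsqN⟩ := discr_emod_four_eq_one_and_squarefree_natAbs_of_odd h2 hodd
  haveI : NeZero (NumberField.discr K).natAbs := ⟨Int.natAbs_ne_zero.mpr hDneg.ne⟩
  -- `3` splits in `K`, so `3 ∤ d_K`
  have hpD : ¬ ((3 : ℕ) : ℤ) ∣ NumberField.discr K :=
    Literature.SatisfiesHeegnerHypothesis.not_dvd_discr h2 hH3 Nat.prime_three dvd_rfl
  -- canonical `S₀` (ISO-3b): every place of `S₀` is bad, hence divides `N_W`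
  obtain ⟨hq, hns, Φ₀, m, _, φ, d, _, ψ, S₀, hΦ, hφ, hψ, hφ0, hψ0, hS3, hgood, hbad, hbal⟩ :=
    (subrowDatum_iff_canonical (W := W) q).mp hD
  have hS₀N : ∀ v ∈ S₀, Rat.HeightOneSpectrum.natGenerator v ∣ W.conductorNorm ℤ :=
    fun v hv ↦ (W.dvd_conductorNorm_iff v).mpr (hbad v hv)
  -- the primes of `d_K` are good places `≠ 3` of `W`, so `gcd(m, d_K) = gcd(d, d_K) = 1`
  have hgoodD : ∀ v : HeightOneSpectrum (𝓞 ℚ), Rat.HeightOneSpectrum.natGenerator v ∣ (NumberField.discr K).natAbs →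
      ((3 : ℕ) : 𝓞 ℚ) ∉ v.asIdeal ∧ W.HasGoodReductionAt v := by
    intro v hvD
    have hvD' : ((Rat.HeightOneSpectrum.natGenerator v : ℕ) : ℤ) ∣ NumberField.discr K := Int.natCast_dvd.mpr hvD
    have hℓ3 : Rat.HeightOneSpectrum.natGenerator v ≠ 3 := fun h ↦ hpD (h ▸ hvD')
    refine ⟨fun h ↦ hℓ3 ((Nat.prime_dvd_prime_iff_eq (Rat.HeightOneSpectrum.prime_natGenerator v) Nat.prime_three).mp
      ((Rat.natCast_mem_asIdeal_iff v).mp h)), ?_⟩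
    refine hasGoodReductionAt_of_not_dvd_conductorNorm W v fun hvN ↦ ?_
    exact Literature.SatisfiesHeegnerHypothesis.not_dvd_discr h2 hHN (Rat.HeightOneSpectrum.prime_natGenerator v) hvN hvD'
  obtain ⟨hmD, hdD⟩ := coprime_level_of_good_off hΦ hφ hψ hφ0 hψ0 hgoodD
  -- the Jacobi character of `K` and the radical `√d_K`
  obtain ⟨χ, hχ2, hχp, hχJ, hχrad⟩ := exists_quadraticChar_geomSqrt_of_emod_four (p := 3) hp2 hD4 hsqN
  -- the sign-equivariant identification `e : Wd[3] ≃ W[3]`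
  have hD0 : ((NumberField.discr K : ℤ) : ℚ) ≠ 0 := by exact_mod_cast hDneg.ne
  obtain ⟨e, hpos, hneg, hpos', hneg', -, -⟩ :=
    exists_signEquiv_signs (W := W) (Wd := Wd) (p := 3) hp2 hDneg hpD C hC
  -- the places of `d_K`
  obtain ⟨T, hT, hST, hTD, hTp, hTS, hTcop, hTp'⟩ := exists_places_discr h2 Nat.prime_three hpD hHN S₀ hS₀N
  have hTgood : ∀ v ∈ T, W.HasGoodReductionAt v := fun v hv ↦ hgood v (hTS v hv) (hTp v hv)
  have hχ1 : ∀ v ∈ S₀, χ (Rat.HeightOneSpectrum.natGenerator v : ZMod (NumberField.discr K).natAbs) = 1 :=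
    fun v hv ↦ chi_natCast_eq_one_of_heegner' h2 hD4 hHN χ hχJ (Rat.HeightOneSpectrum.prime_natGenerator v) (hS₀N v hv)
  -- assemble the datum at `Wd`
  refine ⟨hq, not_hasSplitMultiplicativeReductionAtPrime_of_smul_eq_quadraticTwist W Wd hK 3 hp2 hmult hns hH3 hC,
    Φ₀.map e.symm.toAddMonoidHom, m * (NumberField.discr K).natAbs, inferInstance, _,
    d * (NumberField.discr K).natAbs, inferInstance, _, S₀ ∪ T,
    isRationalLine_map_signEquiv e.symm _ hpos' hneg' hΦ,
    isPrimitive_changeLevel_mul_changeLevel hφ hχp hmD, isPrimitive_changeLevel_mul_changeLevel hψ hχp hdD,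
    fun σ Q hQ ↦ smul_eq_twistChar_of_mem_map_symm e hpos hneg hD0 χ hχ2 hχrad φ hφ0 σ Q hQ,
    fun σ Q ↦ smul_sub_twistChar_mem_map_symm e hpos hneg hD0 χ hχ2 hχrad Φ₀ ψ hψ0 σ Q, ?_, ?_, ?_⟩
  · -- `3 ∉ S₀ ∪ T`
    exact fun v hv ↦ (Finset.mem_union.mp hv).elim (hS3 v) (hTp v)
  · -- `Wd` is good off `S₀ ∪ T ∪ {3}`
    intro v hv hpv
    rw [Finset.mem_union, not_or] at hv
    have hvD : ¬ ((Rat.HeightOneSpectrum.natGenerator v : ℕ) : ℤ) ∣ NumberField.discr K :=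
      fun h ↦ hv.2 ((hT v).mpr (Int.natCast_dvd.mp h))
    exact hasGoodReductionAt_of_smul_eq_quadraticTwist hD4 C hC v hvD (hgood v hv.1 hpv)
  · -- the balance over `S₀ ∪ T` («c(E^K) = c(E)»)
    exact (balance_union_iff φ ψ _ _ S₀ T hST
      (fun v hv ↦ delta_twist_eq_of_heegner W K 3 h2 hHN v (hS₀N v hv) C hC)
      (fun v hv ↦ delta_twist_eq_zero_of_dvd_discr W K 3 h2 v (hTD v hv) (hTgood v hv) C hC)
      (fun v hv ↦ twistChar_natCast_of_apply_eq_one φ χ (hχ1 v hv))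
      (fun v hv ↦ twistChar_natCast_of_apply_eq_one ψ χ (hχ1 v hv))
      (fun v hv ↦ twistChar_natCast_of_not_coprime φ χ (hTcop v hv))
      (fun v hv ↦ twistChar_natCast_of_not_coprime ψ χ (hTcop v hv)) hTp' 1).mpr hbal

/-! ## §3. Along a certified two-step edge -/

/-- **THE SUB-ROW IS CLOSED DOWNSTREAM in the admissible double-twist graph**: if `(W, 3)` is multiplicative at `3` and
on the sub-row and `TwoStepAt 3 W W″` (x2-p1-w6 g3's certified edge: `K` Heegner for `N_W` and `3`, `d_K` odd,
`Wd` a minimal model of `E^{(d_K)}`, `K″` Heegner for `N_{Wd}` and `3`, `d_{K″}` odd, `W″` a minimal model of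
`Wd^{(d_{K″})}`), then `(W″, 3)` is on the sub-row (§2 twice; `Wd` is multiplicative at `3` again by
`X2.hasMultiplicativeReductionAtPrime_of_smul_eq_quadraticTwist`). With ISO-2 (`subrowDatum_of_isIsogenous`) the same
holds for every curve `ℚ`-isogenous to such a `W″`. [cite: GreenbergVatsal2000, §2 Prop. (2.4) p. 22 and §3 (28) p. 42]
[cite: SilvermanAEC2009, X.5 Cor. 5.4 and VII.5 Prop. 5.1] -/
theorem subrowDatum_of_twoStepAt {W W'' : WeierstrassCurve ℚ} (h : TwoStepAt 3 W W'')
    (hmult : W.HasMultiplicativeReductionAtPrime 3) (q : ℕ)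
    (hD : q = 3 ∧ ¬ W.HasSplitMultiplicativeReductionAtPrime 3 ∧
      ∃ (Φ₀ : AddSubgroup (geomTorsion W (3 : ℤ))) (m : ℕ) (_ : NeZero m) (φ : DirichletCharacter (ZMod 3) m)
        (d : ℕ) (_ : NeZero d) (ψ : DirichletCharacter (ZMod 3) d) (S₀ : Finset (HeightOneSpectrum (𝓞 ℚ))),
        IsRationalLine W 3 Φ₀ ∧ φ.IsPrimitive ∧ ψ.IsPrimitive ∧
        (∀ (σ : absoluteGaloisGroup ℚ), ∀ P ∈ Φ₀,
          σ • P = (φ ((modNCyclotomicCharacter ℚ m σ : (ZMod m)ˣ) : ZMod m)).val • P) ∧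
        (∀ (σ : absoluteGaloisGroup ℚ) (P : geomTorsion W (3 : ℤ)),
          σ • P - (ψ ((modNCyclotomicCharacter ℚ d σ : (ZMod d)ˣ) : ZMod d)).val • P ∈ Φ₀) ∧
        (∀ v ∈ S₀, ((3 : ℕ) : 𝓞 ℚ) ∉ v.asIdeal) ∧
        (∀ v : HeightOneSpectrum (𝓞 ℚ), v ∉ S₀ → ((3 : ℕ) : 𝓞 ℚ) ∉ v.asIdeal → W.HasGoodReductionAt v) ∧
        1 + ∑ v ∈ S₀, delta W 3 v =
          ∑ v ∈ S₀, ((if φ (Rat.HeightOneSpectrum.natGenerator v : ZMod m) =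
                (Rat.HeightOneSpectrum.natGenerator v : ZMod 3)
              then sFactor 3 (Rat.HeightOneSpectrum.natGenerator v) else 0) +
            (if ψ (Rat.HeightOneSpectrum.natGenerator v : ZMod d) =
                (Rat.HeightOneSpectrum.natGenerator v : ZMod 3)
              then sFactor 3 (Rat.HeightOneSpectrum.natGenerator v) else 0))) :
    q = 3 ∧ ¬ W''.HasSplitMultiplicativeReductionAtPrime 3 ∧
      ∃ (Φ₀ : AddSubgroup (geomTorsion W'' (3 : ℤ))) (m : ℕ) (_ : NeZero m) (φ : DirichletCharacter (ZMod 3) m)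
        (d : ℕ) (_ : NeZero d) (ψ : DirichletCharacter (ZMod 3) d) (S₀ : Finset (HeightOneSpectrum (𝓞 ℚ))),
        IsRationalLine W'' 3 Φ₀ ∧ φ.IsPrimitive ∧ ψ.IsPrimitive ∧
        (∀ (σ : absoluteGaloisGroup ℚ), ∀ P ∈ Φ₀,
          σ • P = (φ ((modNCyclotomicCharacter ℚ m σ : (ZMod m)ˣ) : ZMod m)).val • P) ∧
        (∀ (σ : absoluteGaloisGroup ℚ) (P : geomTorsion W'' (3 : ℤ)),
          σ • P - (ψ ((modNCyclotomicCharacter ℚ d σ : (ZMod d)ˣ) : ZMod d)).val • P ∈ Φ₀) ∧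
        (∀ v ∈ S₀, ((3 : ℕ) : 𝓞 ℚ) ∉ v.asIdeal) ∧
        (∀ v : HeightOneSpectrum (𝓞 ℚ), v ∉ S₀ → ((3 : ℕ) : 𝓞 ℚ) ∉ v.asIdeal → W''.HasGoodReductionAt v) ∧
        1 + ∑ v ∈ S₀, delta W'' 3 v =
          ∑ v ∈ S₀, ((if φ (Rat.HeightOneSpectrum.natGenerator v : ZMod m) =
                (Rat.HeightOneSpectrum.natGenerator v : ZMod 3)
              then sFactor 3 (Rat.HeightOneSpectrum.natGenerator v) else 0) +
            (if ψ (Rat.HeightOneSpectrum.natGenerator v : ZMod d) =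
                (Rat.HeightOneSpectrum.natGenerator v : ZMod 3)
              then sFactor 3 (Rat.HeightOneSpectrum.natGenerator v) else 0)) := by
  obtain ⟨iW, iWm, iW'', iW''m, K, _, _, hK, hHN, hH3, hodd, -, -, Wd, iWd, iWdm, ⟨C, hC⟩, K'', _, _, hK'', hodd'', -,
    hHN'', hH3'', -, C'', hC''⟩ := h
  have hp2 : (3 : ℕ) ≠ 2 := by decide
  have hpD : ¬ ((3 : ℕ) : ℤ) ∣ NumberField.discr K :=
    Literature.SatisfiesHeegnerHypothesis.not_dvd_discr hK.1 hH3 Nat.prime_three dvd_rfl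
  -- step 1: `W ↦ Wd`
  have h1 := subrowDatum_twist W K hK hodd hHN hH3 Wd C hC hmult q hD
  -- step 2: `Wd ↦ W″` (`Wd` is multiplicative at `3` again)
  have hmultd : Wd.HasMultiplicativeReductionAtPrime 3 :=
    hasMultiplicativeReductionAtPrime_of_smul_eq_quadraticTwist W Wd hC 3 hp2 hpD hmult
  exact subrowDatum_twist Wd K'' hK'' hodd'' hHN'' hH3'' W'' C'' hC'' hmultd q h1

end Summit.BirchSwinnertonDyer.BirchSwinnertonDyer.Theorems.EisensteinPrimesMazurMCOnCellBTwistbackSubrowDatumTwistStep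

end
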